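import Summits.BirchSwinnertonDyer.BirchSwinnertonDyer.Theorems.BiquadraticEisensteinDescentManinDatumSupercuspidalCMInertOfKato
import Summits.BirchSwinnertonDyer.BirchSwinnertonDyer.Theorems.AdditiveKolyvaginRoadManinFrameResidueProperRTameTwistOrderCoprime
import Summits.BirchSwinnertonDyer.BirchSwinnertonDyer.Theorems.InertBadSignedBranchesInertBadAtThreeOddPrimeInstances
import Summits.BirchSwinnertonDyer.Rank1Residual.X12.InertBadLocalTypes
import Mathlib.NumberTheory.LegendreSymbol.QuadraticReciprocity
import HarnessLib

set_option linter.dupNamespace false -- `Summit.BirchSwinnertonDyer.BirchSwinnertonDyer.Theorems.…` (summit = sub, D-0017)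
set_option autoImplicit false

/-!
# Crux `ManinDatumSupercuspidalCMInert` (stmt-BirchSwinnertonDyer-20111, BED r605): DOMINANCE — the plain odd CM statements
# H₅ / H₇ of `…OfPlainOddInstances` FOLLOW from Kato's fact F″ (the reshaping of the residual loses nothing)

Route `BiquadraticEisensteinDescent` (cell `pub/bsd-wall`, width seat `bsd-wall-cm-bed-w4` g10; `--supports`
stmt-BirchSwinnertonDyer-20111, helper). THEOREMS ONLY (no definition, no named fact, no `sorry`); nothing is closed by this file and
BSD is not proved by any of it.

`…ManinDatumSupercuspidalCMInertOfPlainOddInstances` (this seat) closes the registered stubs `stub_S5` / `stub_S7` behind the two plain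
odd prime-modulus statements H₅ (`j = 0`, `p = 5`, `ℓ ≡ 19 (mod 20)`) and H₇ (`j = 1728`, `p = 7`, `ℓ ≡ 47, 59, 83 (mod 84)`) instead of
the XL named fact F″ = `kato_neron_isIntegral_twistedSymbolSum_of_additive_five_le` of `…OfKato` (bed-w1 g0). This file records,
kernel-checked, that the new residual is NOT STRONGER than the old one: **F″ ⟹ H₅** (`plainOddFive_of_kato`) and **F″ ⟹ H₇**
(`plainOddSeven_of_kato`). Ingredients: the class of `ℓ` gives back the lever's side conditions (`4 ∤ ℓ − 1`, `p ∤ ℓ − 1`, `r ∤ ℓ − 1`,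
and `p` a square mod `ℓ` by quadratic reciprocity: `isSquare_five_of_mod_twenty`, `isSquare_seven_of_mod_eightyFour`), hence F″'s
completion-degree clause (`ManinFrameResidueProperRTameTwist.coprime_orderOf_sub_one`, manin-p1 g4); its no-`p`-torsion clause is
`…OfKato.noPTorsion_padic_five_of_j_eq_zero` / `…_seven_of_j_eq_1728`; additivity and irreducibility from CM (`j ∈ {0, 1728}`:
`hasCM_of_j_eq_zero/1728`, `X12.cmInert_iff_mod_three_eq_two_of_j_eq_zero` / `X12.cmInert_iff_mod_four_eq_three_of_j_eq_1728`,
`X12.irr_of_cmInert`); the symmetrised Euler factor of F″ is `1` for a CM curve (`…InertBadAtThreeOddPrimeInstances.symmEuler_eq_one_of_hasCM`).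

References: [Kato2004Asterisque] Thm. 9.7 (p. 189); [KimNakamura2020] Cor. 2.4; [KostersPannekoek2017] Thm. 1, Cor. 2; [Mazur1977]
Ch. III §5 Step 1; [Mazur1978] §6 Prop. 6.3 (1); [Cox2013] Prop. 5.16.
-/

noncomputable section

open scoped Classical MatrixGroups

open WeierstrassCurve NumberField Literature.NumberTheory.EllipticCurves
  Literature.NumberTheory.EllipticCurves.ModularForms
  Literature.NumberTheory.EllipticCurves.Rank1Residual
  CongruenceSubgroup Complex

namespace Summit.BirchSwinnertonDyer.BirchSwinnertonDyer.Theorems.BiquadraticEisensteinDescentManinDatumSupercuspidalCMInertPlainOddOfKato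

open Summit.BirchSwinnertonDyer.Rank1Residual
open Summit.BirchSwinnertonDyer.BirchSwinnertonDyer.Theorems.BiquadraticEisensteinDescentManinDatumSupercuspidalCMInertOfKato
  (noPTorsion_padic_five_of_j_eq_zero noPTorsion_padic_seven_of_j_eq_1728)
open Summit.BirchSwinnertonDyer.BirchSwinnertonDyer.Theorems.ManinFrameResidueProperRTameTwist (coprime_orderOf_sub_one)
open Summit.BirchSwinnertonDyer.BirchSwinnertonDyer.Theorems.InertBadSignedBranchesInertBadAtThreeOddPrimeInstances
  (symmEuler_eq_one_of_hasCM)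

/-! ## §1 The classes of `ℓ` give back the lever's side conditions (quadratic reciprocity, converse direction) -/

/-- `3, 5, 6` are not squares mod `7`. [folklore] -/
private theorem not_isSquare_zmod_seven {k : ℕ} (hk : k = 3 ∨ k = 5 ∨ k = 6) :
    ¬ IsSquare ((k : ℕ) : ZMod 7) := by
  rcases hk with rfl | rfl | rfl <;> decide

/-- `4` is a square mod `5`. [folklore] -/
private theorem isSquare_four_zmod_five : IsSquare ((4 : ℕ) : ZMod 5) := by decide

/-- **`7` is a square modulo every prime `ℓ ≡ 47, 59, 83 (mod 84)`**: `ℓ ≡ 3 (mod 4)` and `ℓ ≡ 3, 5, 6 (mod 7)`, so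
`(7/ℓ) = −(ℓ/7) = 1`. [folklore] -/
theorem isSquare_seven_of_mod_eightyFour {d : ℕ} (hd : d.Prime) (h84 : d % 84 = 47 ∨ d % 84 = 59 ∨ d % 84 = 83) :
    IsSquare ((7 : ℕ) : ZMod d) := by
  haveI : Fact d.Prime := ⟨hd⟩
  haveI : Fact (Nat.Prime 7) := ⟨by norm_num⟩
  have h4 : d % 4 = 3 := by omega
  have h7 : d % 7 = 3 ∨ d % 7 = 5 ∨ d % 7 = 6 := by omega
  have h70 : ((7 : ℤ) : ZMod d) ≠ 0 := by
    intro h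
    have : ((7 : ℕ) : ZMod d) = 0 := by exact_mod_cast h
    rw [ZMod.natCast_eq_zero_iff] at this
    exact absurd (Nat.le_of_dvd (by norm_num) this) (by omega)
  have hneg : legendreSym 7 d = -1 := by
    rw [legendreSym.mod, legendreSym.eq_neg_one_iff, show ((d : ℤ) % ((7 : ℕ) : ℤ)) = ((d % 7 : ℕ) : ℤ) from
      (Int.natCast_mod d 7).symm, Int.cast_natCast]
    exact not_isSquare_zmod_seven h7
  have hrec : legendreSym d 7 = -legendreSym 7 d := by
    have := legendreSym.quadratic_reciprocity_three_mod_four (p := 7) (q := d) (by norm_num) h4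
    exact_mod_cast this
  have hleg : legendreSym d 7 = 1 := by rw [hrec, hneg]; norm_num
  have := (legendreSym.eq_one_iff d h70).mp hleg
  exact_mod_cast this

/-- **`5` is a square modulo every prime `ℓ ≡ 19 (mod 20)`**: `ℓ ≡ 4 (mod 5)`, so `(5/ℓ) = (ℓ/5) = (4/5) = 1`. [folklore] -/
theorem isSquare_five_of_mod_twenty {d : ℕ} (hd : d.Prime) (h20 : d % 20 = 19) : IsSquare ((5 : ℕ) : ZMod d) := by
  haveI : Fact d.Prime := ⟨hd⟩
  haveI : Fact (Nat.Prime 5) := ⟨by norm_num⟩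
  have h5 : d % 5 = 4 := by omega
  have h50 : ((5 : ℤ) : ZMod d) ≠ 0 := by
    intro h
    have : ((5 : ℕ) : ZMod d) = 0 := by exact_mod_cast h
    rw [ZMod.natCast_eq_zero_iff] at this
    exact absurd (Nat.le_of_dvd (by norm_num) this) (by omega)
  have h40 : (((4 : ℕ) : ℤ) : ZMod 5) ≠ 0 := by
    rw [Int.cast_natCast, Ne, ZMod.natCast_eq_zero_iff]; omega
  have hpos : legendreSym 5 d = 1 := by
    rw [legendreSym.mod, show ((d : ℤ) % ((5 : ℕ) : ℤ)) = ((d % 5 : ℕ) : ℤ) from (Int.natCast_mod d 5).symm, h5,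
      legendreSym.eq_one_iff 5 h40, Int.cast_natCast]
    exact isSquare_four_zmod_five
  have hrec : legendreSym d 5 = legendreSym 5 d := by
    have := legendreSym.quadratic_reciprocity_one_mod_four (p := 5) (q := d) (by norm_num) (by omega)
    exact_mod_cast this
  have hleg : legendreSym d 5 = 1 := by rw [hrec, hpos]
  have := (legendreSym.eq_one_iff d h50).mp hleg
  exact_mod_cast this

/-! ## §2 F″ ⟹ H₇ and F″ ⟹ H₅ -/

/-- The odd character `χ` of prime modulus `ℓ` with `p ∤ ℓ − 1` is primitive, `≠ 1`, of order prime to `p` (the three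
character clauses of F″). [folklore] -/
private theorem character_clauses {ℓ p : ℕ} (hℓ : ℓ.Prime) (hpℓ : ¬ p ∣ ℓ - 1) (χ : DirichletCharacter ℂ ℓ)
    (hχ : χ.Odd) : χ.IsPrimitive ∧ χ ≠ 1 ∧ ¬ p ∣ orderOf χ := by
  haveI : NeZero ℓ := ⟨hℓ.ne_zero⟩
  have hχ1 : χ ≠ 1 := by
    intro h
    have h1 : χ (-1) = -1 := hχ
    rw [h, MulChar.one_apply (isUnit_one.neg)] at h1
    norm_num at h1
  refine ⟨?_, hχ1, ?_⟩
  · rw [DirichletCharacter.isPrimitive_def]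
    rcases (Nat.dvd_prime hℓ).mp (DirichletCharacter.conductor_dvd_level χ) with h | h
    · exact absurd (DirichletCharacter.eq_one_iff_conductor_eq_one.mpr h) hχ1
    · exact h
  · intro h
    have h1 : orderOf χ ∣ Fintype.card (DirichletCharacter ℂ ℓ) := orderOf_dvd_card
    have h2 : Fintype.card (DirichletCharacter ℂ ℓ) = ℓ.totient := by
      rw [← Nat.card_eq_fintype_card]
      exact DirichletCharacter.card_eq_totient_of_hasEnoughRootsOfUnity ℂ ℓ
    rw [h2, Nat.totient_prime hℓ] at h1
    exact hpℓ (h.trans h1)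

/-- **F″ ⟹ H₇.** GRANTED Kato's fact `kato_neron_isIntegral_twistedSymbolSum_of_additive_five_le`: for every globally minimal `V`
with `j(V) = 1728` bad at `7`, its newform `f` at conductor level, every prime `ℓ ∤ N_V` with `ℓ ≡ 47, 59, 83 (mod 84)`, every ODD
`χ (mod ℓ)` and `ϖ, r` with `ϖ·Ω⁻(V) = Ω⁻_f`, `Σ_a χ(a){∞, a/ℓ}_f = r·Ω⁻_f·i`: `s·ϖ·r ∈ ℤ̄` for some `7 ∤ s`. (`V` is CM by `ℤ[i]`,
hence additive at `7` with `V[7]` irreducible (`7 ≡ 3 (mod 4)` inert) and `V(ℚ₇)[7] = 0`; the class of `ℓ` gives `4 ∤ ℓ − 1`,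
`7 ∤ ℓ − 1`, `3 ∤ ℓ − 1`, `7` a square mod `ℓ`, so F″'s completion-degree clause holds; the Euler factor is `1`.)
[cite: Kato2004Asterisque, Thm. 9.7 (p. 189)] [cite: KimNakamura2020, Cor. 2.4] [cite: KostersPannekoek2017, Thm. 1 and Cor. 2] -/
theorem plainOddSeven_of_kato (hK : kato_neron_isIntegral_twistedSymbolSum_of_additive_five_le) :
    ∀ (V : WeierstrassCurve ℚ) [V.IsElliptic] [V.IsGloballyMinimal] [NeZero (V.conductorNorm ℤ)],
      V.j = 1728 → ¬ V.HasGoodReductionAtPrime 7 →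
      ∀ (f : CuspForm (CongruenceSubgroup.Gamma0 (V.conductorNorm ℤ)) 2), IsNewformOf V f →
      ∀ (ℓ : ℕ) [NeZero ℓ], ℓ.Prime → ¬ ℓ ∣ V.conductorNorm ℤ → (ℓ % 84 = 47 ∨ ℓ % 84 = 59 ∨ ℓ % 84 = 83) →
      ∀ χ : DirichletCharacter ℂ ℓ, χ.Odd →
      ∀ (ϖ : ℚ) (r : ℂ), (ϖ : ℝ) * V.imaginaryPeriodRat = minusPeriod f →
        twistedSymbolSum f χ = r * (minusPeriod f : ℂ) * Complex.I →
        ∃ s : ℕ, ¬ 7 ∣ s ∧ IsIntegral ℤ ((s : ℂ) * ϖ * r) := by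
  intro V _ _ _ hj hbad f hf ℓ _ hℓ hℓN h84 χ hχ ϖ r hϖ hval
  haveI : Fact (Nat.Prime 7) := ⟨by norm_num⟩
  have hCM : V.HasCM := WeierstrassCurve.hasCM_of_j_eq_1728 V hj
  have hmult : ¬ V.HasMultiplicativeReductionAtPrime 7 := V.not_hasMultiplicativeReductionAtPrime_of_hasCM hCM 7
  have hin : CMInert V 7 := (X12.cmInert_iff_mod_four_eq_three_of_j_eq_1728 V 7 (by norm_num) hj).mpr (by norm_num)
  have hirr : Irr V 7 := X12.irr_of_cmInert V 7 (by norm_num) hin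
  have hℓ7 : 7 ≠ ℓ := by omega
  have hℓ2 : ℓ ≠ 2 := by omega
  have hm : ℓ.Coprime (7 * V.conductorNorm ℤ) :=
    Nat.Coprime.mul_right ((Nat.coprime_primes hℓ (by norm_num)).mpr (Ne.symm hℓ7)) ((hℓ.coprime_iff_not_dvd).mpr hℓN)
  have h4 : ¬ 4 ∣ ℓ - 1 := by omega
  have hpℓ : ¬ 7 ∣ ℓ - 1 := by omega
  have hrd : ∀ q : ℕ, q.Prime → q ≠ 2 → q ∣ 7 - 1 → ¬ q ∣ ℓ - 1 := by
    intro q hq hq2 hq6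
    have hq6' : q ≤ 6 := Nat.le_of_dvd (by norm_num) hq6
    interval_cases q
    · exact absurd hq (by decide)
    · exact absurd hq (by decide)
    · exact absurd rfl hq2
    · omega
    · exact absurd hq (by decide)
    · exact absurd hq6 (by decide)
    · exact absurd hq (by decide)
  have hsq : IsSquare (((7 : ℕ) : ZMod ℓ)) := isSquare_seven_of_mod_eightyFour hℓ h84
  have hex : 7 < 7 ∨ (Nat.Coprime (orderOf ((7 : ZMod ℓ))) (7 - 1) ∧
      ∀ P : (V.baseChange ℚ_[7]).toAffine.Point, 7 • P = 0 → P = 0) :=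
    Or.inr ⟨coprime_orderOf_sub_one (by norm_num) hℓ hℓ2 hℓ7 h4 hrd hsq,
      noPTorsion_padic_seven_of_j_eq_1728 V rfl ⟨hbad, hmult⟩ hj⟩
  obtain ⟨hprim, hχ1, hord⟩ := character_clauses hℓ hpℓ χ hχ
  have hval' : (∏ q ∈ (V.conductorNorm ℤ).primeFactors with ¬ q ^ 2 ∣ V.conductorNorm ℤ,
      (((q : ℂ) - (V.LFunction q : ℂ) * χ (q : ZMod ℓ)) * ((q : ℂ) - (V.LFunction q : ℂ) * (χ (q : ZMod ℓ))⁻¹))) *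
      twistedSymbolSum f χ = r * (minusPeriod f : ℂ) * Complex.I := by
    rw [symmEuler_eq_one_of_hasCM V hCM χ, one_mul]
    exact hval
  exact (hK V f hf 7 (by norm_num) hbad hmult hirr ℓ hm hex χ hprim hχ1 hord ϖ r).2 hχ hϖ hval'

/-- **F″ ⟹ H₅.** GRANTED Kato's fact `kato_neron_isIntegral_twistedSymbolSum_of_additive_five_le`: for every globally minimal `V`
with `j(V) = 0` bad at `5`, its newform `f` at conductor level, every prime `ℓ ∤ N_V` with `ℓ ≡ 19 (mod 20)`, every ODD `χ (mod ℓ)`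
and `ϖ, r` with `ϖ·Ω⁻(V) = Ω⁻_f`, `Σ_a χ(a){∞, a/ℓ}_f = r·Ω⁻_f·i`: `s·ϖ·r ∈ ℤ̄` for some `5 ∤ s`. (`V` is CM by `ℤ[ω]`, hence additive
at `5` with `V[5]` irreducible (`5 ≡ 2 (mod 3)` inert) and `V(ℚ₅)[5] = 0`; the class of `ℓ` gives `4 ∤ ℓ − 1`, `5 ∤ ℓ − 1`, `5` a
square mod `ℓ` (no odd prime divides `5 − 1`); the Euler factor is `1`.)
[cite: Kato2004Asterisque, Thm. 9.7 (p. 189)] [cite: KimNakamura2020, Cor. 2.4] [cite: KostersPannekoek2017, Thm. 1 and Cor. 2] -/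
theorem plainOddFive_of_kato (hK : kato_neron_isIntegral_twistedSymbolSum_of_additive_five_le) :
    ∀ (V : WeierstrassCurve ℚ) [V.IsElliptic] [V.IsGloballyMinimal] [NeZero (V.conductorNorm ℤ)],
      V.j = 0 → ¬ V.HasGoodReductionAtPrime 5 →
      ∀ (f : CuspForm (CongruenceSubgroup.Gamma0 (V.conductorNorm ℤ)) 2), IsNewformOf V f →
      ∀ (ℓ : ℕ) [NeZero ℓ], ℓ.Prime → ¬ ℓ ∣ V.conductorNorm ℤ → ℓ % 20 = 19 →
      ∀ χ : DirichletCharacter ℂ ℓ, χ.Odd →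
      ∀ (ϖ : ℚ) (r : ℂ), (ϖ : ℝ) * V.imaginaryPeriodRat = minusPeriod f →
        twistedSymbolSum f χ = r * (minusPeriod f : ℂ) * Complex.I →
        ∃ s : ℕ, ¬ 5 ∣ s ∧ IsIntegral ℤ ((s : ℂ) * ϖ * r) := by
  intro V _ _ _ hj hbad f hf ℓ _ hℓ hℓN h20 χ hχ ϖ r hϖ hval
  haveI : Fact (Nat.Prime 5) := ⟨by norm_num⟩
  have hCM : V.HasCM := WeierstrassCurve.hasCM_of_j_eq_zero V hj
  have hmult : ¬ V.HasMultiplicativeReductionAtPrime 5 := V.not_hasMultiplicativeReductionAtPrime_of_hasCM hCM 5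
  have hin : CMInert V 5 :=
    (X12.cmInert_iff_mod_three_eq_two_of_j_eq_zero V 5 (by norm_num) (by norm_num) hj).mpr (by norm_num)
  have hirr : Irr V 5 := X12.irr_of_cmInert V 5 (by norm_num) hin
  have hℓ5 : 5 ≠ ℓ := by omega
  have hℓ2 : ℓ ≠ 2 := by omega
  have hm : ℓ.Coprime (5 * V.conductorNorm ℤ) :=
    Nat.Coprime.mul_right ((Nat.coprime_primes hℓ (by norm_num)).mpr (Ne.symm hℓ5)) ((hℓ.coprime_iff_not_dvd).mpr hℓN)
  have h4 : ¬ 4 ∣ ℓ - 1 := by omega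
  have hpℓ : ¬ 5 ∣ ℓ - 1 := by omega
  have hrd : ∀ q : ℕ, q.Prime → q ≠ 2 → q ∣ 5 - 1 → ¬ q ∣ ℓ - 1 := by
    intro q hq hq2 hq4
    have hq4' : q ≤ 4 := Nat.le_of_dvd (by norm_num) hq4
    interval_cases q
    · exact absurd hq (by decide)
    · exact absurd hq (by decide)
    · exact absurd rfl hq2
    · exact absurd hq4 (by decide)
    · exact absurd hq (by decide)
  have hsq : IsSquare (((5 : ℕ) : ZMod ℓ)) := isSquare_five_of_mod_twenty hℓ h20
  have hex : 7 < 5 ∨ (Nat.Coprime (orderOf ((5 : ZMod ℓ))) (5 - 1) ∧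
      ∀ P : (V.baseChange ℚ_[5]).toAffine.Point, 5 • P = 0 → P = 0) :=
    Or.inr ⟨coprime_orderOf_sub_one (by norm_num) hℓ hℓ2 hℓ5 h4 hrd hsq,
      noPTorsion_padic_five_of_j_eq_zero V rfl ⟨hbad, hmult⟩ hj⟩
  obtain ⟨hprim, hχ1, hord⟩ := character_clauses hℓ hpℓ χ hχ
  have hval' : (∏ q ∈ (V.conductorNorm ℤ).primeFactors with ¬ q ^ 2 ∣ V.conductorNorm ℤ,
      (((q : ℂ) - (V.LFunction q : ℂ) * χ (q : ZMod ℓ)) * ((q : ℂ) - (V.LFunction q : ℂ) * (χ (q : ZMod ℓ))⁻¹))) *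
      twistedSymbolSum f χ = r * (minusPeriod f : ℂ) * Complex.I := by
    rw [symmEuler_eq_one_of_hasCM V hCM χ, one_mul]
    exact hval
  exact (hK V f hf 5 (by norm_num) hbad hmult hirr ℓ hm hex χ hprim hχ1 hord ϖ r).2 hχ hϖ hval'

end Summit.BirchSwinnertonDyer.BirchSwinnertonDyer.Theorems.BiquadraticEisensteinDescentManinDatumSupercuspidalCMInertPlainOddOfKato

end
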